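import Literature.NumberTheory.EllipticCurves.ZpExtensionEisensteinOrdinaryCoreIsotropyOfLiftsProofs
import Literature.NumberTheory.EllipticCurves.TorsionFilAtCyclicOfOrdinaryPointProofs
import Literature.NumberTheory.EllipticCurves.TorsionFilAtCyclicMultiplicativeThreeProofs
import HarnessLib

/-!
# H.4 at `v ∣ p`, isotropy of the strict ordinary cores, from ONE ordinary point — no good-reduction hypothesis; and the twin's
# Tate line at a multiplicative `v ∣ 3` (assembly; theorems only, no definition, no named fact, no instance, no `sorry`)

Topic `NumberTheory/EllipticCurves` (cell `pub/bsd-print-x9`, D1 road, H.4 at `v ∣ p`; LEAD `bsd-wall-utd-p1` for crux r205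
stmt-BirchSwinnertonDyer-24737 `…UniversalToricDescent.TwinAlgMuZeroAtThree`, line `beta-road`, stub `stub_howardOutputsOfFamily`, E2 unit).
`ZpExtensionEisensteinOrdinaryCoreIsotropyProofs` / `…OfLiftsProofs` prove the isotropy half of Howard's H.4 at a place `v ∋ p` of GOOD
ORDINARY reduction (`p ∤ a_v`), the reduction type entering ONLY through the cyclicity of `Fil_v E[p^k]`
(`pairing_torsionFilAt_eq_zero_of_not_dvd_frobeniusTraceAt`).  With `TorsionFilAtCyclicOfOrdinaryPointProofs` (cyclicity from ONE
`p`-torsion point outside `Fil_v E[p]`, at any place) the same assembly runs under that hypothesis alone: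

* `conjPairing_torsionFilAt_eq_zero_of_exists_not_mem`, `isotropic_ordinaryCore_of_exists_not_mem`,
  `localCup_ordinaryCore_eq_zero_of_exists_not_mem` — x9's three statements for a curve over `K` with `(hgood, hpv, p ∤ a_v)` replaced by
  `hord : ∃ P : E[p], P ∉ Fil_v E[p]` (any finite place `v`);
* `isotropic_ordinaryCore_ofLifts_of_exists_not_mem` — the same for `E = W ⊗ K` and the canonical conjugation datum `ofLifts` (place
  compatibility `torsionMap_delta_apply_mem_torsionFilAt` is generic);
* **`isotropic_ordinaryCore_ofLifts_of_hasMultiplicativeReductionAt_three`** — at a place `v ∋ 3` of MULTIPLICATIVE reduction of `W ⊗ K`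
  (the ordinary point is `TorsionFilAtCyclicMultiplicativeThreeProofs.exists_not_mem_torsionFilAt_of_hasMultiplicativeReductionAt_three`):
  the strict Tate-line cores of `F_𝔮` at `v` and `σ • v` annihilate each other under the local pairing of the level-`k` Eisenstein duality
  datum — the (Iso) input `hOrth` of x9's `eisensteinTower_isSelfOrthogonalAt_of_mem` for the twin `E′` of crux 24737 at `3 ∥ N′`.

References: B. Howard, Compositio Math. 140 (2004), §1.3 H.4, Rem. 1.3.2, Lemma 3.1.1, Def. 3.2.6 (arXiv:1202.6340 p. 7 L69–90, p. 15 L56–62,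
p. 16 L108–110) [Howard2004HeegnerKolyvagin]; R. Greenberg, LNM 1716 (1999), §1 p. 62 [GreenbergLNM1716]; J. H. Silverman, AEC (2009),
III.8.1, VII.2.1–2.2 [SilvermanAEC2009]; ATAEC (1994) V.3 [SilvermanATAEC1994].  BSD is not proved by any of this.
-/

noncomputable section

open scoped ContRepresentation
open NumberField IsDedekindDomain Field

namespace WeierstrassCurve

open Literature.NumberTheory.EllipticCurves Literature.NumberTheory.GaloisRepresentations
  Literature.NumberTheory.GaloisCohomology.Howard2004 Literature.NumberTheory.EllipticCurves.ZpExtension IwasawaAlgebra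

/-! ## §1 A curve over `K`: isotropy from one ordinary point -/

section General

variable {K : Type} [Field K] [NumberField K] (W : WeierstrassCurve K) [W.IsElliptic] {p : ℕ} [hp : Fact p.Prime] {m : ℕ}
  (hm : 1 ≤ m) (k : ℕ) (cd : ConjugationDatum K) (κ : ZpExtension K p)
  (t : ∀ j, (W.torsionGaloisModule ((p : ℤ) ^ (j + 1))).toContRepresentation →ⁱL
    (W.torsionGaloisModule ((p : ℤ) ^ j)).toContRepresentation)
  (ht : ∀ j (P : geomTorsion W ((p : ℤ) ^ (j + 1))), t j P = W.geomTorsionReduce p j P)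
  (e : geomTorsion W ((p : ℤ) ^ k) →+ geomTorsion W ((p : ℤ) ^ k) →+ DiscreteGaloisModule.MuCarrier K (p ^ k))
  (θ : geomTorsion W ((p : ℤ) ^ k) →+ geomTorsion W ((p : ℤ) ^ k))
  (log : DiscreteGaloisModule.MuCarrier K (p ^ k) →+ ZMod (p ^ k))
  (hsymm : ∀ a b, conjPairing e θ log a b = conjPairing e θ log b a)
  (hequiv : ∀ (g : absoluteGaloisGroup K) (a b : geomTorsion W ((p : ℤ) ^ k)),
    conjPairing e θ log (W.torsionGaloisModule _ g a) (W.torsionGaloisModule _ (cd.conj g) b) =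
      cyclotomicCharacterModPow K p k g * conjPairing e θ log a b)
  (hnd : ∀ w, (∀ b, conjPairing e θ log w b = 0) → w = 0)
  (hex : ∀ φ : geomTorsion W ((p : ℤ) ^ k) →+ ZMod (p ^ k), ∃ w, ∀ b, conjPairing e θ log w b = φ b)
  (hκ : ∀ g : absoluteGaloisGroup K,
    p ^ eisensteinLevel (p := p) hm k ∣ κ.twistExponent (eisensteinLevel (p := p) hm k) g +
      κ.twistExponent (eisensteinLevel (p := p) hm k) (cd.conj g))

/-- **The `E`-level clause of Howard's Lemma 3.1.1 from one ordinary point**: with `e(a, a) = 0` (Weil), `θ ∘ g` carrying `Fil'` into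
`Fil_v E[p^k]`, and some `p`-torsion point outside `Fil_v E[p]`, the form `ẽ(a, b) = log e(a, θ b)` kills `Fil_v × g Fil'` — because
`Fil_v E[p^k]` is cyclic (`TorsionFilAtCyclicOfOrdinaryPointProofs`). No reduction hypothesis at `v`.
[cite: Howard2004HeegnerKolyvagin, Rem. 1.3.2 and Lemma 3.1.1 (arXiv p. 7 L81–88, p. 15 L60–62)] [cite: GreenbergLNM1716, §1 p. 62] -/
theorem conjPairing_torsionFilAt_eq_zero_of_exists_not_mem (v : HeightOneSpectrum (𝓞 K))
    (hord : ∃ P : geomTorsion W (p : ℤ), P ∉ W.torsionFilAt v (p : ℤ))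
    (hself : ∀ a, e a a = 0) (g : geomTorsion W ((p : ℤ) ^ k) →+ geomTorsion W ((p : ℤ) ^ k))
    (Fil' : AddSubgroup (geomTorsion W ((p : ℤ) ^ k)))
    (hθg : ∀ a' ∈ Fil', θ (g a') ∈ W.torsionFilAt v ((p : ℤ) ^ k)) :
    ∀ a ∈ W.torsionFilAt v ((p : ℤ) ^ k), ∀ a' ∈ Fil', conjPairing e θ log a (g a') = 0 :=
  conjPairing_eq_zero_of_isotropic e θ log g (W.torsionFilAt v ((p : ℤ) ^ k)).toAddSubgroup Fil' hθg
    (W.pairing_torsionFilAt_eq_zero_of_exists_not_mem v hord k e hself)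

/-- **H.4 at `v`, isotropy half, from one ordinary point** (any finite place `v`, no reduction hypothesis): for the Eisenstein duality
datum of level `k` built from `ẽ = conjPairing e θ log` (`e(a, a) = 0`) and a conjugation datum whose `θ ∘ δ_v` carries `Fil_v̄ E[p^k]`
into `Fil_v E[p^k]`, the strict ordinary cores at `v` and (transported) at `v̄ = σ • v` are mutually orthogonal under the induced local
pairing. [cite: Howard2004HeegnerKolyvagin, H.4, Lemma 3.1.1 and Def. 3.2.6 (arXiv p. 7 L78–82, p. 15 L60–62, p. 16 L108–110)]
[cite: GreenbergLNM1716, §1 p. 62] -/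
theorem isotropic_ordinaryCore_of_exists_not_mem (v : HeightOneSpectrum (𝓞 K))
    (hord : ∃ P : geomTorsion W (p : ℤ), P ∉ W.torsionFilAt v (p : ℤ)) (hself : ∀ a, e a a = 0)
    (hθδ : ∀ a' ∈ W.torsionFilAt (cd.σ • v) ((p : ℤ) ^ k),
      θ (W.torsionGaloisModule ((p : ℤ) ^ k) (cd.δ v) a') ∈ W.torsionFilAt v ((p : ℤ) ^ k)) :
    (∀ x ∈ (W.ordinaryFiltrationAt v t ht).ordinaryCore hm k,
      ∀ y ∈ ((W.ordinaryFiltrationAt (cd.σ • v) t ht).ordinaryCore hm k).map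
        (cd.transportH1 (κ.eisensteinTwist (W.torsionGaloisModule ((p : ℤ) ^ k)) hm k) v),
        (eisensteinDualityDatum hm k cd κ (W.torsionGaloisModule ((p : ℤ) ^ k)) (conjPairing e θ log) hsymm hequiv hnd hex
          hκ).localCup (Sum.inr v) x y = 0) ∧
    (∀ y ∈ ((W.ordinaryFiltrationAt (cd.σ • v) t ht).ordinaryCore hm k).map
        (cd.transportH1 (κ.eisensteinTwist (W.torsionGaloisModule ((p : ℤ) ^ k)) hm k) v),
      ∀ x ∈ (W.ordinaryFiltrationAt v t ht).ordinaryCore hm k,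
        (eisensteinDualityDatum hm k cd κ (W.torsionGaloisModule ((p : ℤ) ^ k)) (conjPairing e θ log) hsymm hequiv hnd hex
          hκ).localCup (Sum.inr v) x y = 0) :=
  isotropic_ordinaryCore hm k cd κ hκ (fun j ↦ W.torsionGaloisModule ((p : ℤ) ^ j)) t (conjPairing e θ log) hsymm hequiv hnd
    hex v (W.ordinaryFiltrationAt v t ht) (W.ordinaryFiltrationAt (cd.σ • v) t ht)
    (W.conjPairing_torsionFilAt_eq_zero_of_exists_not_mem k e θ log v hord hself
      (W.torsionGaloisModule ((p : ℤ) ^ k) (cd.δ v)).toAddMonoidHom (W.torsionFilAt (cd.σ • v) ((p : ℤ) ^ k)).toAddSubgroup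
      hθδ)

/-- The same, one pair at a time: `⟨x, y⟩_v = 0` for `x` in the strict ordinary core at `v` and `y` in the transport of the one at
`v̄`, from one ordinary point at `v`. [cite: Howard2004HeegnerKolyvagin, H.4 and Lemma 3.1.1] -/
theorem localCup_ordinaryCore_eq_zero_of_exists_not_mem (v : HeightOneSpectrum (𝓞 K))
    (hord : ∃ P : geomTorsion W (p : ℤ), P ∉ W.torsionFilAt v (p : ℤ)) (hself : ∀ a, e a a = 0)
    (hθδ : ∀ a' ∈ W.torsionFilAt (cd.σ • v) ((p : ℤ) ^ k),
      θ (W.torsionGaloisModule ((p : ℤ) ^ k) (cd.δ v) a') ∈ W.torsionFilAt v ((p : ℤ) ^ k))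
    {x : galoisCohomology ((κ.eisensteinTwist (W.torsionGaloisModule ((p : ℤ) ^ k)) hm k).toLocal (Sum.inr v)) 1}
    (hx : x ∈ (W.ordinaryFiltrationAt v t ht).ordinaryCore hm k)
    {y : galoisCohomology ((cd.twist (κ.eisensteinTwist (W.torsionGaloisModule ((p : ℤ) ^ k)) hm k)).toLocal (Sum.inr v)) 1}
    (hy : y ∈ ((W.ordinaryFiltrationAt (cd.σ • v) t ht).ordinaryCore hm k).map
      (cd.transportH1 (κ.eisensteinTwist (W.torsionGaloisModule ((p : ℤ) ^ k)) hm k) v)) :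
    (eisensteinDualityDatum hm k cd κ (W.torsionGaloisModule ((p : ℤ) ^ k)) (conjPairing e θ log) hsymm hequiv hnd hex
      hκ).localCup (Sum.inr v) x y = 0 :=
  (W.isotropic_ordinaryCore_of_exists_not_mem hm k cd κ t ht e θ log hsymm hequiv hnd hex hκ v hord hself hθδ).1 x hx y hy

end General

/-! ## §2 `E = W ⊗ K` with the canonical conjugation datum `ofLifts` -/

section OfLifts

variable {K : Type} [Field K] [NumberField K] (W : WeierstrassCurve ℚ) [W.IsElliptic] {p : ℕ} [hp : Fact p.Prime] {m : ℕ}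
  (hm : 1 ≤ m) (k : ℕ) (σ : K ≃ₐ[ℚ] K) (hσ₁ : σ ≠ 1) (hσ : σ * σ = 1) (τ : AlgebraicClosure K ≃+* AlgebraicClosure K)
  (hτ : IsLiftOfAut σ τ) (hτ₂ : Function.Involutive τ) (κ : ZpExtension K p)
  (t : ∀ j, ((W.baseChange K).torsionGaloisModule ((p : ℤ) ^ (j + 1))).toContRepresentation →ⁱL
    ((W.baseChange K).torsionGaloisModule ((p : ℤ) ^ j)).toContRepresentation)
  (ht : ∀ j (P : geomTorsion (W.baseChange K) ((p : ℤ) ^ (j + 1))), t j P = (W.baseChange K).geomTorsionReduce p j P)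
  (e : geomTorsion (W.baseChange K) ((p : ℤ) ^ k) →+ geomTorsion (W.baseChange K) ((p : ℤ) ^ k) →+
    DiscreteGaloisModule.MuCarrier K (p ^ k))
  (log : DiscreteGaloisModule.MuCarrier K (p ^ k) →+ ZMod (p ^ k))
  (hsymm : ∀ a b, conjPairing e (hτ.torsionMap W ((p : ℤ) ^ k)) log a b = conjPairing e (hτ.torsionMap W ((p : ℤ) ^ k)) log b a)
  (hequiv : ∀ (g : absoluteGaloisGroup K) (a b : geomTorsion (W.baseChange K) ((p : ℤ) ^ k)),
    conjPairing e (hτ.torsionMap W ((p : ℤ) ^ k)) log ((W.baseChange K).torsionGaloisModule _ g a)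
        ((W.baseChange K).torsionGaloisModule _ ((ConjugationDatum.ofLifts σ hσ₁ hσ τ hτ hτ₂).conj g) b) =
      cyclotomicCharacterModPow K p k g * conjPairing e (hτ.torsionMap W ((p : ℤ) ^ k)) log a b)
  (hnd : ∀ w, (∀ b, conjPairing e (hτ.torsionMap W ((p : ℤ) ^ k)) log w b = 0) → w = 0)
  (hex : ∀ φ : geomTorsion (W.baseChange K) ((p : ℤ) ^ k) →+ ZMod (p ^ k), ∃ w, ∀ b,
    conjPairing e (hτ.torsionMap W ((p : ℤ) ^ k)) log w b = φ b)
  (hκ : ∀ g : absoluteGaloisGroup K,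
    p ^ eisensteinLevel (p := p) hm k ∣ κ.twistExponent (eisensteinLevel (p := p) hm k) g +
      κ.twistExponent (eisensteinLevel (p := p) hm k) ((ConjugationDatum.ofLifts σ hσ₁ hσ τ hτ hτ₂).conj g))

/-- **Howard's H.4 at `v`, isotropy half, for `E = W ⊗ K` and the canonical conjugation datum, from one ordinary point at `v`** (no
reduction hypothesis): for the Eisenstein duality datum of level `k` built from `(s, t) ↦ log e(s, τ t)` with `e(a, a) = 0`, the strict
ordinary core of `F_𝔮` at `v` and the transport of the one at `v̄ = σ • v` annihilate each other under the induced local pairing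
(`E₁(K̄_v)` is canonical: `torsionMap_delta_apply_mem_torsionFilAt`). [cite: Howard2004HeegnerKolyvagin, H.4, Rem. 1.3.2, Lemma 3.1.1 and Def. 3.2.6 (arXiv p. 7 L69–90, p. 15 L60–62, p. 16 L108–110)]
[cite: GreenbergLNM1716, §1 p. 62] [cite: SilvermanAEC2009, Props. VII.2.1–2.2] -/
theorem isotropic_ordinaryCore_ofLifts_of_exists_not_mem (v : HeightOneSpectrum (𝓞 K))
    (hord : ∃ P : geomTorsion (W.baseChange K) (p : ℤ), P ∉ (W.baseChange K).torsionFilAt v (p : ℤ))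
    (hself : ∀ a, e a a = 0) :
    (∀ x ∈ ((W.baseChange K).ordinaryFiltrationAt v t ht).ordinaryCore hm k,
      ∀ y ∈ (((W.baseChange K).ordinaryFiltrationAt ((ConjugationDatum.ofLifts σ hσ₁ hσ τ hτ hτ₂).σ • v) t ht).ordinaryCore
          hm k).map ((ConjugationDatum.ofLifts σ hσ₁ hσ τ hτ hτ₂).transportH1
            (κ.eisensteinTwist ((W.baseChange K).torsionGaloisModule ((p : ℤ) ^ k)) hm k) v),
        (eisensteinDualityDatum hm k (ConjugationDatum.ofLifts σ hσ₁ hσ τ hτ hτ₂) κ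
          ((W.baseChange K).torsionGaloisModule ((p : ℤ) ^ k)) (conjPairing e (hτ.torsionMap W ((p : ℤ) ^ k)) log) hsymm
          hequiv hnd hex hκ).localCup (Sum.inr v) x y = 0) ∧
    (∀ y ∈ (((W.baseChange K).ordinaryFiltrationAt ((ConjugationDatum.ofLifts σ hσ₁ hσ τ hτ hτ₂).σ • v) t ht).ordinaryCore
          hm k).map ((ConjugationDatum.ofLifts σ hσ₁ hσ τ hτ hτ₂).transportH1
            (κ.eisensteinTwist ((W.baseChange K).torsionGaloisModule ((p : ℤ) ^ k)) hm k) v),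
      ∀ x ∈ ((W.baseChange K).ordinaryFiltrationAt v t ht).ordinaryCore hm k,
        (eisensteinDualityDatum hm k (ConjugationDatum.ofLifts σ hσ₁ hσ τ hτ hτ₂) κ
          ((W.baseChange K).torsionGaloisModule ((p : ℤ) ^ k)) (conjPairing e (hτ.torsionMap W ((p : ℤ) ^ k)) log) hsymm
          hequiv hnd hex hκ).localCup (Sum.inr v) x y = 0) := by
  haveI : CharZero ((σ • v).adicCompletion K) := charZero_of_injective_algebraMap (algebraMap K _).injective
  haveI : CharZero (v.adicCompletion K) := charZero_of_injective_algebraMap (algebraMap K _).injective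
  haveI : (W.baseChange K).IsElliptic := by rw [WeierstrassCurve.baseChange]; infer_instance
  exact (W.baseChange K).isotropic_ordinaryCore_of_exists_not_mem hm k (ConjugationDatum.ofLifts σ hσ₁ hσ τ hτ hτ₂) κ
    t ht e (hτ.torsionMap W ((p : ℤ) ^ k)) log hsymm hequiv hnd hex hκ v hord hself
    (fun a' ha' ↦ W.torsionMap_delta_apply_mem_torsionFilAt σ hσ₁ hσ τ hτ hτ₂ v ((p : ℤ) ^ k) ha')

end OfLifts

/-! ## §3 The twin: the Tate line at a place `v ∣ 3` of multiplicative reduction -/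

section Twin

variable {K : Type} [Field K] [NumberField K] (W : WeierstrassCurve ℚ) [W.IsElliptic] [hp : Fact (Nat.Prime 3)] {m : ℕ}
  (hm : 1 ≤ m) (k : ℕ) (σ : K ≃ₐ[ℚ] K) (hσ₁ : σ ≠ 1) (hσ : σ * σ = 1) (τ : AlgebraicClosure K ≃+* AlgebraicClosure K)
  (hτ : IsLiftOfAut σ τ) (hτ₂ : Function.Involutive τ) (κ : ZpExtension K 3)
  (t : ∀ j, ((W.baseChange K).torsionGaloisModule (((3 : ℕ) : ℤ) ^ (j + 1))).toContRepresentation →ⁱL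
    ((W.baseChange K).torsionGaloisModule (((3 : ℕ) : ℤ) ^ j)).toContRepresentation)
  (ht : ∀ j (P : geomTorsion (W.baseChange K) (((3 : ℕ) : ℤ) ^ (j + 1))), t j P = (W.baseChange K).geomTorsionReduce 3 j P)
  (e : geomTorsion (W.baseChange K) (((3 : ℕ) : ℤ) ^ k) →+ geomTorsion (W.baseChange K) (((3 : ℕ) : ℤ) ^ k) →+
    DiscreteGaloisModule.MuCarrier K (3 ^ k))
  (log : DiscreteGaloisModule.MuCarrier K (3 ^ k) →+ ZMod (3 ^ k))
  (hsymm : ∀ a b, conjPairing e (hτ.torsionMap W (((3 : ℕ) : ℤ) ^ k)) log a b = conjPairing e (hτ.torsionMap W (((3 : ℕ) : ℤ) ^ k)) log b a)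
  (hequiv : ∀ (g : absoluteGaloisGroup K) (a b : geomTorsion (W.baseChange K) (((3 : ℕ) : ℤ) ^ k)),
    conjPairing e (hτ.torsionMap W (((3 : ℕ) : ℤ) ^ k)) log ((W.baseChange K).torsionGaloisModule _ g a)
        ((W.baseChange K).torsionGaloisModule _ ((ConjugationDatum.ofLifts σ hσ₁ hσ τ hτ hτ₂).conj g) b) =
      cyclotomicCharacterModPow K 3 k g * conjPairing e (hτ.torsionMap W (((3 : ℕ) : ℤ) ^ k)) log a b)
  (hnd : ∀ w, (∀ b, conjPairing e (hτ.torsionMap W (((3 : ℕ) : ℤ) ^ k)) log w b = 0) → w = 0)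
  (hex : ∀ φ : geomTorsion (W.baseChange K) (((3 : ℕ) : ℤ) ^ k) →+ ZMod (3 ^ k), ∃ w, ∀ b,
    conjPairing e (hτ.torsionMap W (((3 : ℕ) : ℤ) ^ k)) log w b = φ b)
  (hκ : ∀ g : absoluteGaloisGroup K,
    3 ^ eisensteinLevel (p := 3) hm k ∣ κ.twistExponent (eisensteinLevel (p := 3) hm k) g +
      κ.twistExponent (eisensteinLevel (p := 3) hm k) ((ConjugationDatum.ofLifts σ hσ₁ hσ τ hτ hτ₂).conj g))

/-- **Howard's H.4 at `v ∣ 3`, isotropy half, for `E = W ⊗ K` MULTIPLICATIVE at `v ∋ 3`** (the twin `E′` of crux 24737 at the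
degree-one places above `3 ∥ N′`): for the Eisenstein duality datum of level `k` built from `(s, t) ↦ log e(s, τ t)` with `e(a, a) = 0`
(the Weil pairing) and the canonical conjugation datum, the strict Tate-line cores of `F_𝔮` at `v` and the transport of the one at
`v̄ = σ • v` annihilate each other under the induced local pairing — the (Iso) input `hOrth` of x9's `eisensteinTower_isSelfOrthogonalAt_of_mem`
at `v ∣ 3`, with NO good-reduction / unit-root hypothesis (ordinary point = `TorsionFilAtCyclicMultiplicativeThreeProofs`).
[cite: Howard2004HeegnerKolyvagin, H.4, Rem. 1.3.2, Lemma 3.1.1 and Def. 3.2.6 (arXiv p. 7 L69–90, p. 15 L60–62, p. 16 L108–110)]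
[cite: SilvermanATAEC1994, V.3 (Tate curve: E[p^k] ∩ E₁ = μ_{p^k})] -/
theorem isotropic_ordinaryCore_ofLifts_of_hasMultiplicativeReductionAt_three (v : HeightOneSpectrum (𝓞 K))
    (h3v : ((3 : ℕ) : 𝓞 K) ∈ v.asIdeal) (hmult : (W.baseChange K).HasMultiplicativeReductionAt v)
    (hself : ∀ a, e a a = 0) :
    (∀ x ∈ ((W.baseChange K).ordinaryFiltrationAt v t ht).ordinaryCore hm k,
      ∀ y ∈ (((W.baseChange K).ordinaryFiltrationAt ((ConjugationDatum.ofLifts σ hσ₁ hσ τ hτ hτ₂).σ • v) t ht).ordinaryCore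
          hm k).map ((ConjugationDatum.ofLifts σ hσ₁ hσ τ hτ hτ₂).transportH1
            (κ.eisensteinTwist ((W.baseChange K).torsionGaloisModule (((3 : ℕ) : ℤ) ^ k)) hm k) v),
        (eisensteinDualityDatum hm k (ConjugationDatum.ofLifts σ hσ₁ hσ τ hτ hτ₂) κ
          ((W.baseChange K).torsionGaloisModule (((3 : ℕ) : ℤ) ^ k)) (conjPairing e (hτ.torsionMap W (((3 : ℕ) : ℤ) ^ k)) log) hsymm
          hequiv hnd hex hκ).localCup (Sum.inr v) x y = 0) ∧
    (∀ y ∈ (((W.baseChange K).ordinaryFiltrationAt ((ConjugationDatum.ofLifts σ hσ₁ hσ τ hτ hτ₂).σ • v) t ht).ordinaryCore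
          hm k).map ((ConjugationDatum.ofLifts σ hσ₁ hσ τ hτ hτ₂).transportH1
            (κ.eisensteinTwist ((W.baseChange K).torsionGaloisModule (((3 : ℕ) : ℤ) ^ k)) hm k) v),
      ∀ x ∈ ((W.baseChange K).ordinaryFiltrationAt v t ht).ordinaryCore hm k,
        (eisensteinDualityDatum hm k (ConjugationDatum.ofLifts σ hσ₁ hσ τ hτ hτ₂) κ
          ((W.baseChange K).torsionGaloisModule (((3 : ℕ) : ℤ) ^ k)) (conjPairing e (hτ.torsionMap W (((3 : ℕ) : ℤ) ^ k)) log) hsymm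
          hequiv hnd hex hκ).localCup (Sum.inr v) x y = 0) := by
  haveI : (W.baseChange K).IsElliptic := by rw [WeierstrassCurve.baseChange]; infer_instance
  exact W.isotropic_ordinaryCore_ofLifts_of_exists_not_mem hm k σ hσ₁ hσ τ hτ hτ₂ κ t ht e log hsymm hequiv hnd hex hκ v
    ((W.baseChange K).exists_not_mem_torsionFilAt_of_hasMultiplicativeReductionAt_three v h3v hmult) hself

end Twin

end WeierstrassCurve

end
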